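import Summits.RiemannHypothesis.RiemannHypothesis.Theorems.IntegerScrewScrewUpperSlack
import HarnessLib

/-!
# Crux `ScrewPolyFloor` (stmt-RiemannHypothesis-15757) — negative lemmas: the exponent `A` is at least `1`

TIGHTNESS of the polynomial floor `λ_min(S_M) ≥ c · M^{-A}` for Suzuki's screw-kernel Gram
matrices `S_M = [G(log m, log m')]_{2 ≤ m,m' ≤ M}`.  The crux quantifies `∃ A c, 0 < c ∧ (floor at
(A, c))`; below, "floor at `(A, c)`" is its matrix inequality at a FIXED pair, always written out.
From the landed, RH-free upper slack `screwUpperSlack_proof` (two-point test vector `𝟙_M − 𝟙_{M−1}`: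
`x·S_M·x = 2Ψ(log(M/(M−1))) ≤ 16 (log M)³ / M · Σ x²` for `M ≥ 4`) we get, unconditionally:

* `floor_le_upperSlack` — every floor pair is dominated: `c · M^{-A} ≤ C (log M)³ / M` for `M ≥ M₀`;
* `one_le_of_floor` — hence **`A ≥ 1`**: no floor decays slower than `1/M` (up to logarithms);
* `not_floor_of_lt_one` — the natural strengthening "the crux with a prescribed exponent `A < 1`"
  is FALSE; in particular `not_uniformFloor`: there is no uniform floor `λ_min(S_M) ≥ c > 0`
  (the matrices are NOT uniformly positive definite), and no growing floor;
* `screwPolyFloor_exponent_ge_one` — read on the crux itself: any witness pair has `1 ≤ A`.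

So the numerically observed law `λ_min(S_M)·M ≈ 0.25` (route numerics, `M ≤ 4000`) sits exactly at
the boundary `A = 1` permitted here; whether `A = 1` is attained (even under RH) is open — the
landed `floorOfRH_proof` gives some large `A`.  Refuter, cdisprove cycle 1.  Theorems only.
-/

noncomputable section

namespace Summit.RiemannHypothesis.Cruxes.ScrewPolyFloor.Negative

open Literature.NumberTheory.LFunctions Filter Asymptotics
open Summit.RiemannHypothesis.RiemannHypothesis.Theses.IntegerScrew
open Summit.RiemannHypothesis.RiemannHypothesis.Theorems
open scoped BigOperators Topology

/-- **Quantitative tightness.** Every floor pair `(A, c)` is dominated by the RH-free upper slack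
of the tree (`screwUpperSlack_proof`): `c · M^{-A} ≤ C (log M)³ / M` for all `M ≥ M₀`
(with the tree's witness, `C = 16`, `M₀ = 4`).  No positivity of `c` needed. -/
theorem floor_le_upperSlack {A c : ℝ}
    (h : ∀ (M : ℕ) (x : ℕ → ℝ),
      c * (M : ℝ) ^ (-A) * ∑ m ∈ Finset.Icc 2 M, x m ^ 2 ≤
        ∑ m ∈ Finset.Icc 2 M, ∑ m' ∈ Finset.Icc 2 M,
          zetaScrewKernel (Real.log m) (Real.log m') * (x m * x m')) :
    ∃ C : ℝ, ∃ M₀ : ℕ, ∀ M : ℕ, M₀ ≤ M →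
      c * (M : ℝ) ^ (-A) ≤ C * Real.log M ^ 3 / M := by
  obtain ⟨C, M₀, hU⟩ := screwUpperSlack_proof
  refine ⟨C, M₀, fun M hM => ?_⟩
  obtain ⟨x, hpos, hle⟩ := hU M hM
  exact le_of_mul_le_mul_right (le_trans (h M x) hle) hpos

/-- **The exponent of any polynomial floor is at least `1`.**  If `c > 0` and
`c · M^{-A} · Σ_{2 ≤ m ≤ M} x_m² ≤ x·S_M·x` for all `M, x`, then `1 ≤ A`: otherwise
`c · M^{1-A} ≤ C (log M)³` for all large `M`, contradicting `(log M)³ = o(M^{1-A})`. -/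
theorem one_le_of_floor {A c : ℝ} (hc : 0 < c)
    (h : ∀ (M : ℕ) (x : ℕ → ℝ),
      c * (M : ℝ) ^ (-A) * ∑ m ∈ Finset.Icc 2 M, x m ^ 2 ≤
        ∑ m ∈ Finset.Icc 2 M, ∑ m' ∈ Finset.Icc 2 M,
          zetaScrewKernel (Real.log m) (Real.log m') * (x m * x m')) :
    1 ≤ A := by
  by_contra hA
  rw [not_le] at hA
  obtain ⟨C, M₀, hb⟩ := floor_le_upperSlack h
  have hs : 0 < 1 - A := by linarith
  -- `(log x)^3 = o(x^{1-A})` along the reals, with the constant `c / (2 (|C| + 1))`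
  have hlo := isLittleO_log_rpow_rpow_atTop ((3 : ℕ) : ℝ) hs
  simp only [Real.rpow_natCast] at hlo
  have hCpos : 0 < |C| + 1 := by positivity
  have hε : 0 < c / 2 / (|C| + 1) := by positivity
  have hev : ∀ᶠ x : ℝ in atTop, (|C| + 1) * Real.log x ^ 3 ≤ c / 2 * x ^ (1 - A) := by
    filter_upwards [hlo.def hε, eventually_ge_atTop (1 : ℝ)] with x hx hx1
    have hlog : 0 ≤ Real.log x := Real.log_nonneg hx1
    rw [Real.norm_eq_abs, Real.norm_eq_abs, abs_of_nonneg (pow_nonneg hlog 3),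
      abs_of_nonneg (Real.rpow_nonneg (by linarith) _)] at hx
    have e : (|C| + 1) * (c / 2 / (|C| + 1) * x ^ (1 - A)) = c / 2 * x ^ (1 - A) := by
      field_simp
    calc (|C| + 1) * Real.log x ^ 3 ≤ (|C| + 1) * (c / 2 / (|C| + 1) * x ^ (1 - A)) :=
          mul_le_mul_of_nonneg_left hx hCpos.le
      _ = c / 2 * x ^ (1 - A) := e
  -- evaluate at a large natural number `M ≥ max M₀ 1`
  have hevN := (tendsto_natCast_atTop_atTop (R := ℝ)).eventually hev
  obtain ⟨M, hM1, hM2⟩ := (hevN.and (eventually_ge_atTop (max M₀ 1))).exists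
  have hMM₀ : M₀ ≤ M := le_trans (le_max_left _ _) hM2
  have hM1' : 1 ≤ M := le_trans (le_max_right _ _) hM2
  have hMpos : (0 : ℝ) < M := by exact_mod_cast hM1'
  have hbM := hb M hMM₀
  -- `c M^{-A} · M ≤ C (log M)^3 ≤ (|C|+1) (log M)^3 ≤ (c/2) M^{1-A}`
  have h1 : c * (M : ℝ) ^ (-A) * M ≤ C * Real.log M ^ 3 := (le_div_iff₀ hMpos).1 hbM
  have hlog3 : 0 ≤ Real.log (M : ℝ) ^ 3 :=
    pow_nonneg (Real.log_nonneg (by exact_mod_cast hM1')) 3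
  have h2 : C * Real.log M ^ 3 ≤ (|C| + 1) * Real.log M ^ 3 :=
    mul_le_mul_of_nonneg_right (by linarith [le_abs_self C]) hlog3
  have hpow : (M : ℝ) ^ (1 - A) = (M : ℝ) ^ (-A) * M := by
    rw [sub_eq_neg_add, Real.rpow_add hMpos, Real.rpow_one]
  have hpos : 0 < (M : ℝ) ^ (1 - A) := Real.rpow_pos_of_pos hMpos _
  have h3 : c * (M : ℝ) ^ (1 - A) ≤ c / 2 * (M : ℝ) ^ (1 - A) := by
    calc c * (M : ℝ) ^ (1 - A) = c * (M : ℝ) ^ (-A) * M := by rw [hpow, mul_assoc]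
      _ ≤ C * Real.log M ^ 3 := h1
      _ ≤ (|C| + 1) * Real.log M ^ 3 := h2
      _ ≤ c / 2 * (M : ℝ) ^ (1 - A) := hM1
  nlinarith

/-- **Natural strengthening refuted**: the crux with a PRESCRIBED exponent `A < 1`
(`∃ c > 0, floor at (A, c)`) is false, unconditionally. -/
theorem not_floor_of_lt_one {A : ℝ} (hA : A < 1) :
    ¬ (∃ c : ℝ, 0 < c ∧ ∀ (M : ℕ) (x : ℕ → ℝ),
        c * (M : ℝ) ^ (-A) * ∑ m ∈ Finset.Icc 2 M, x m ^ 2 ≤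
          ∑ m ∈ Finset.Icc 2 M, ∑ m' ∈ Finset.Icc 2 M,
            zetaScrewKernel (Real.log m) (Real.log m') * (x m * x m')) :=
  fun ⟨_, hc, h⟩ => absurd (one_le_of_floor hc h) (not_le.2 hA)

/-- **No uniform floor** (the case `A = 0`): the screw-kernel Gram matrices on the log-integers
are not uniformly positive definite — `λ_min(S_M) ≥ c > 0` for all `M` is false
(unconditionally; indeed `λ_min(S_M) ≤ Ψ(log(M/(M−1))) → 0`). -/
theorem not_uniformFloor :
    ¬ (∃ c : ℝ, 0 < c ∧ ∀ (M : ℕ) (x : ℕ → ℝ),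
        c * ∑ m ∈ Finset.Icc 2 M, x m ^ 2 ≤
          ∑ m ∈ Finset.Icc 2 M, ∑ m' ∈ Finset.Icc 2 M,
            zetaScrewKernel (Real.log m) (Real.log m') * (x m * x m')) := by
  rintro ⟨c, hc, h⟩
  refine not_floor_of_lt_one (A := 0) zero_lt_one ⟨c, hc, fun M x => ?_⟩
  simpa [Real.rpow_zero] using h M x

/-- **No growing floor either** (the case `A < 0`, e.g. `λ_min(S_M) ≥ c · M`): immediate from
`not_floor_of_lt_one`; recorded because the crux's `∃ A : ℝ` ranges over all reals. -/
theorem not_floor_of_neg {A : ℝ} (hA : A < 0) :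
    ¬ (∃ c : ℝ, 0 < c ∧ ∀ (M : ℕ) (x : ℕ → ℝ),
        c * (M : ℝ) ^ (-A) * ∑ m ∈ Finset.Icc 2 M, x m ^ 2 ≤
          ∑ m ∈ Finset.Icc 2 M, ∑ m' ∈ Finset.Icc 2 M,
            zetaScrewKernel (Real.log m) (Real.log m') * (x m * x m')) :=
  not_floor_of_lt_one (by linarith)

/-- The lemma read on the crux: **every witness pair of `ScrewPolyFloor` has exponent `A ≥ 1`**
(so the numerically observed `λ_min(S_M) · M ≈ 0.25` is at the boundary of what is possible,
and a proof of the crux — which is RH-equivalent, `IntegerScrew.screwPolyFloor_iff_riemannHypothesis`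
— can only ever produce `A ≥ 1`). -/
theorem screwPolyFloor_exponent_ge_one (hF : ScrewPolyFloor) :
    ∃ A c : ℝ, 1 ≤ A ∧ 0 < c ∧ ∀ (M : ℕ) (x : ℕ → ℝ),
      c * (M : ℝ) ^ (-A) * ∑ m ∈ Finset.Icc 2 M, x m ^ 2 ≤
        ∑ m ∈ Finset.Icc 2 M, ∑ m' ∈ Finset.Icc 2 M,
          zetaScrewKernel (Real.log m) (Real.log m') * (x m * x m') := by
  obtain ⟨A, c, hc, h⟩ := hF
  exact ⟨A, c, one_le_of_floor hc h, hc, h⟩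

end Summit.RiemannHypothesis.Cruxes.ScrewPolyFloor.Negative

end
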